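import Mathlib

/-!
# SoloBlindNoncompactRoots — the Knapp–Zuckerman step of T0(5)(b): if every root vanishing on `λ`
# is noncompact, the roots vanishing on `λ` are pairwise orthogonal (type `A₁^k`) and their
# reflections pairwise commute

Solo seat `solo-Langlands-blind`, session 12; companion of `SoloBlindWeylDivisibility` (T0(5)).

Dictionary.  `P` = the root system `Φ(𝔥_ℂ, 𝔱_ℂ)` of a real reductive Lie algebra `𝔥` of EQUAL RANK
(`𝔱 ⊆ 𝔨` a compact Cartan subalgebra, so every root is imaginary and is either compact,
`𝔤_α ⊆ 𝔨_ℂ`, or noncompact, `𝔤_α ⊆ 𝔭_ℂ`);  `ε : ι → ZMod 2` = the grading `ε(α) = 0` (compact) /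
`1` (noncompact), additive along root sums because the Cartan involution is a Lie algebra
automorphism acting by `(-1)^{ε(α)}` on `𝔤_α` (`[𝔨,𝔭] ⊆ 𝔭`, `[𝔭,𝔭] ⊆ 𝔨`) — hypothesis `hadd`;
`lam : M →+ L` = evaluation of roots on the (singular) Harish-Chandra parameter `λ` of a limit of
discrete series `π(λ, C)`, so `Δ_λ = {α : lam α = 0}`;  the Knapp–Zuckerman NON-DEGENERACY condition
"`λ` is orthogonal to no compact root" is hypothesis `hnc : lam (α i) = 0 → ε i = 1`.
Conclusion (`pairingIn_eq_zero_of_noncompact`, `isOrthogonal_of_noncompact`,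
`commute_reflection_of_noncompact`): two roots `α ≠ ±β` of `Δ_λ` satisfy `⟨α, β^∨⟩ = 0`, because
`α ± β`, if a root, would lie in `Δ_λ` and be compact; hence `Δ_λ` is of type `A₁^k` and the
reflections generating `W(Δ_λ)` pairwise commute, so `W(Δ_λ) ≅ (ℤ/2)^k` is generated by pairwise
commuting involutions — which `SoloBlindWeylDivisibility.not_generated_by_commuting_involutions`
forbids as soon as `3 ∣ [K : K_cm]`.  Consequently, for such `K`, no member of the archimedean
packet of any non-abelian functorial transfer of a regular algebraic cusp form of `GL_n/K` to any
host with totally real or CM `*`-action is a non-degenerate limit of discrete series (T0(5)(b)).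
The root-system input is Mathlib's `RootPairing.pairingIn_eq_zero_of_add_notMem_of_sub_notMem`
(finite crystallographic root pairings over a domain of characteristic zero).

[cite: KnappZuckerman1982, §1] [cite: KnappVogan1995, (11.190c) p. 716] [cite: Goldring2016, p. 348]
-/

namespace Summit.Langlands.Langlands.Theorems.SoloBlind

open Set Function

variable {ι R M N : Type*} [CommRing R] [CharZero R] [IsDomain R] [AddCommGroup M] [Module R M]
  [AddCommGroup N] [Module R N] (P : RootPairing ι R M N) [Finite ι] [P.IsCrystallographic]

/-- **Knapp–Zuckerman step.**  If every root vanishing on `λ` is noncompact (`ε = 1`) for a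
grading `ε` additive along root sums, then two roots `α_i ≠ ±α_j` vanishing on `λ` have
`⟨α_i, α_j^∨⟩ = 0`. -/
theorem pairingIn_eq_zero_of_noncompact {L : Type*} [AddCommGroup L] (lam : M →+ L)
    (ε : ι → ZMod 2) (hadd : ∀ i j k, P.root i + P.root j = P.root k → ε k = ε i + ε j)
    (hnc : ∀ i, lam (P.root i) = 0 → ε i = 1) {i j : ι}
    (hi : lam (P.root i) = 0) (hj : lam (P.root j) = 0) (hne : i ≠ j)
    (hne' : P.root i ≠ -P.root j) : P.pairingIn ℤ i j = 0 := by
  apply P.pairingIn_eq_zero_of_add_notMem_of_sub_notMem hne hne'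
  · rintro ⟨k, hk⟩
    have hk0 : lam (P.root k) = 0 := by rw [hk, map_add, hi, hj, add_zero]
    have h1 := hnc k hk0
    have h2 := hadd i j k hk.symm
    rw [hnc i hi, hnc j hj] at h2
    rw [h2] at h1
    exact absurd h1 (by decide)
  · rintro ⟨k, hk⟩
    have hk0 : lam (P.root k) = 0 := by rw [hk, map_sub, hi, hj, sub_zero]
    have h1 := hnc k hk0
    have h2 := hadd k j i (by rw [hk, sub_add_cancel])
    rw [hnc i hi, hnc j hj, h1] at h2
    exact absurd h2 (by decide)

/-- Under the same hypotheses the two roots are orthogonal in Mathlib's sense (both pairings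
vanish). -/
theorem isOrthogonal_of_noncompact {L : Type*} [AddCommGroup L] (lam : M →+ L)
    (ε : ι → ZMod 2) (hadd : ∀ i j k, P.root i + P.root j = P.root k → ε k = ε i + ε j)
    (hnc : ∀ i, lam (P.root i) = 0 → ε i = 1) {i j : ι}
    (hi : lam (P.root i) = 0) (hj : lam (P.root j) = 0) (hne : i ≠ j)
    (hne' : P.root i ≠ -P.root j) : P.IsOrthogonal i j := by
  have hne'' : P.root j ≠ -P.root i := fun h => hne' (by rw [h, neg_neg])
  have h1 := pairingIn_eq_zero_of_noncompact P lam ε hadd hnc hi hj hne hne'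
  have h2 := pairingIn_eq_zero_of_noncompact P lam ε hadd hnc hj hi hne.symm hne''
  refine ⟨?_, ?_⟩
  · rw [← P.algebraMap_pairingIn ℤ, h1, map_zero]
  · rw [← P.algebraMap_pairingIn ℤ, h2, map_zero]

/-- … and therefore the reflections `s_{α_i}`, `s_{α_j}` commute: the Weyl group `W(Δ_λ)` is
generated by pairwise commuting involutions. -/
theorem commute_reflection_of_noncompact {L : Type*} [AddCommGroup L] (lam : M →+ L)
    (ε : ι → ZMod 2) (hadd : ∀ i j k, P.root i + P.root j = P.root k → ε k = ε i + ε j)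
    (hnc : ∀ i, lam (P.root i) = 0 → ε i = 1) {i j : ι}
    (hi : lam (P.root i) = 0) (hj : lam (P.root j) = 0) :
    Commute (P.reflection i) (P.reflection j) := by
  by_cases hne : i = j
  · subst hne; exact Commute.refl _
  by_cases hne' : P.root i = -P.root j
  · -- `α_i = -α_j`: the two reflections coincide
    have hij : i = P.reflectionPerm j j := P.root_eq_neg_iff.mp hne'
    have : P.reflection i = P.reflection j := by
      rw [hij, P.reflection_reflectionPerm]
      ext x
      simp
    rw [this]
  · exact P.isOrthogonal_comm i j
      (isOrthogonal_of_noncompact P lam ε hadd hnc hi hj hne hne')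

omit [CharZero R] [IsDomain R] [Finite ι] [P.IsCrystallographic] in
/-- The involution property, for the record: each reflection squares to the identity. -/
theorem reflection_mul_self' (i : ι) : P.reflection i * P.reflection i = 1 := by
  ext x; simp

end Summit.Langlands.Langlands.Theorems.SoloBlind
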